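/-
pub-lace10 cell, TYPER seat (unit `pub-lace10-typer-g0`), Level B of the `d = 10` programme (lead RULING D11, eng E3): the `d := 10` WIRING of the
`h2phi` cell theorems (`F3BoundsCellReductionAltPhi`, numerator `F3Bounds.boundHD75Phi`) with the landed `T`/`U`/`K` sup literals (`SrwCellSupsD10`),
the all-`ℚ` closing layer (twin of `SrwSlotClosingsD10` §1, §3, §4 for the DIRECT `T` slot), the AT-NODE slots for the shell nodes `2e₁`, `e₁+e₂` of `𝒳`,
and the `e₁`-NODE reads needed by the seventh family cell `(1,17,{0}) = ℋ^{1,16}(e₁)` (the `e₁` constructor over the landed `e₁` point values of `𝓙`).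
Additive: no module is modified; every table value is a landed literal read by name; no numeral of record, no tuple, no certificate; no dimension sentence.
-/
import Literature.Probability.FitznerVanDerHofstad2017.F3BoundsCellReductionAltPhi
import Literature.Probability.FitznerVanDerHofstad2017.SrwSlotClosingsD10
import HarnessLib

/-!
# The `h2phi` `f₃` cell theorems at `d := 10`: wiring, all-`ℚ` closings, node slots, and the `e₁`-node reads

CITATION HEADER (PLACEMENT v2). Part of a certified REPRODUCTION of R. Fitzner, R. van der Hofstad, *Generalized approach to the
non-backtracking lace expansion*, PTRF **169** (2017) 1041–1119 [NoBLE17], §3.3.5 (3.58)–(3.64) and (3.87) pp. 1074–1079 (the cell bound of `f₃`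
from the tables `IM`, `T`, `U`, `K`), (3.30) p. 1070 and (3.34)–(3.35) p. 1071 (`𝓙`, the node identities), §5.1 p. 1093 and §5.2 (5.9), (5.11), (5.15)
p. 1092 (the SRW sups), and of R. Fitzner, R. van der Hofstad, *Mean-field behavior for nearest-neighbor percolation in `d > 10`*, EJP **22** (2017)
no. 43 [FvdH17], §2.5 ((2.23): the cells; the numerical assumption is checked entry by entry from rational data):

> [NoBLE17] p. 1079: "the supremum over `S` is attained at one of the lowest-order points of `S`, as all involved functions are monotone decreasing
> in the absolute value of each coordinate".

The quoted sentence is NOT used: every region sup is a kernel-certified literal (`SrwKSupTableD10`, `SrwTUSupTableD10`, `SrwJSupTableD10*`), an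
`𝒳`-cell is read EITHER as a region sup OR per cone + at the two shell nodes (`f3cellD10_calX_le_of_nodes_of_cones_phi`).  Every `[cite:]` tag is a
LOCATOR for comparison, not an appeal to authority: all statements are proved here from tree theorems.

## What is here (`d := 10`; all proved; no hypothesis on any table value)

§1 THE WIRED `h2phi` CELL THEOREMS `f3cellD10D_*_phi` — `F3BoundsCellReductionAltPhi` §3 at `d := 10` with the seven `T`/`U`/`K` binders
   discharged BY NAME exactly as in `CellSupD10.f3cellD10D_*` (direct `T` slot `tXD / tQD / tND`), the per-cone reading of an `𝒳`-cell and the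
   gluing of the three cones of `Q = {‖x‖₁ ≥ 3}` (`boundHD75Phi_Q_le_of_cones`).
§2 CLOSING RULES `boundHD75Phi_cell{XD,QD,ND}_le_of_ratLe`: the numeral hypothesis `hnum` is ONE `decide +kernel` over `ℚ` (`CellNumQ.boundHD75PhiQ`).
§3 PER-SLOT CLOSING THEOREMS with decidable hypotheses only (binders `(α ᾱ : ℚ) (aq : ArgsQ) (IMq : ℤ → ℕ → ℚ) (bq : ℚ)`, the `IM` side through
   `SlotD10.cellChk / coneChk / originChk / negOne…Chk`): `slotXD_{zero,one}_le_phi`, `slotConeD_{zero,one}_le_phi`, `slotQD_{zero,one}_le_phi`,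
   `slotOriginD_one_le_phi`, and the AT-NODE slots `slotND_{zero,one}_at_le_phi` for a node of `𝒳` (its `IM` entries from the `𝒳`-cell check, since
   the node lies in `𝒳`; its `T`/`U`/`K` from the point literals `tND / uN / kN nd`) with `pt_e2_mem_calX`, `pt_e11_mem_calX`.
§4 THE `e₁` NODE (seventh family cell of the `d = 10` record, lead RULINGS D11/D14): the reads `jE1Q` (the LANDED `e₁` point values
   `JSupD10.srwJ_e1_m2l16 / m2l17 / m3l16 / m3l17 / m3l18` of `SrwJSupTableD10E1` §E, by name), `iE1Q` (`I_{n,l}(e₁)`, class `[1]`), `sE1Q`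
   (`S_{p,l}(e₁) ≤ I(3e₁) + I(e₁) + 18·I(2e₁+e₂)`, `srwIShift2_vecOfParts_one_le_of`), the check `e1Chk` with soundness `srwTrueAlt_IM_e1_le_of_chk`,
   and the slot `slotND_one_at_e1_le_phi` (`l ≤ 16`).
§5 CONVENIENCE `IM` TABLES passing the checks by construction (corrected-branch envelope on the natural rows, print's `m = −1` pair in node/cone
   form): `imEX`, `imEC v`, `imEO`, `imEE1` — functions of `(α, ᾱ)` only.

## What is NOT here
No certificate, no value of `α̲`, `ᾱ`, `aq`, `bq`; no engine number; the tables of record and every `d = 11` module are untouched; no `…Of 10` structure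
is instantiated.  Heartbeat census: three `decide +kernel` node identities / memberships; everything else is a one-line composition; no option is set.
-/

noncomputable section

namespace Literature.Probability.FitznerVanDerHofstad2017

namespace SlotD10Phi

open Literature.Barriers.CriticalPhenomena Literature.Probability.LatticeModels
open F3Bounds F3Bounds.CellNumQ KTUD10 KSupD10 TUSupD10 JSupD10 CellSupD10 CellImD10 SlotD10
open KTUD10 (dq)

/-! ### §1  The wired `h2phi` cell theorems at `d := 10` (direct `T` slot) -/

section Wired

variable {afmin afmax : ℝ}

/-- **Cell `(0,l)` over `𝒳`, `boundHD75Phi`, direct `T` slot `tXD α̲`** (`l ≤ 20`) — twin of `CellSupD10.f3cellD10D_zero_calX_le`.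
[cite: FitznerVanDerHofstad2016NoBLE, §3.3.5 (3.87) p. 1079; (3.71)–(3.86); §5.2 (5.9), (5.15)] [cite: FitznerVanDerHofstad2017, §2.5; notebook General.nb In[2]–In[3]] -/
theorem f3cellD10D_zero_calX_le_phi (hα : 1 ≤ afmin) (hᾱ : 1 ≤ afmax) {a : Args} (ha : a.WF)
    {IMc : ℤ → ℕ → ℝ} {l : ℕ} (hl : l ≤ 20) {b : ℝ}
    (hE0 : CellDomAlt 10 afmin afmax 0 l (IMc 0 l)) (hE0' : CellDomAlt 10 afmin afmax 0 (l + 1) (IMc 0 (l + 1)))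
    (hN1 : srwINode2 10 1 (l + 1) + srwIShift2Node2 10 2 l / (2 * ((10 : ℕ) : ℝ) ^ 2 * afmin) ≤ IMc (-1) l)
    (hN2 : srwINode2 10 2 l ≤ ((10 : ℕ) : ℝ) * afmin * IMc (-1) l)
    (hnum : boundHD75Phi (Tables.cell IMc (tXD afmin) uX kX : Tables (Fin 10 → ℤ)) 0 l 0 a ≤ b) :
    ∀ x ∈ calX 10, boundHD75Phi (srwTrueAlt 10 afmin afmax) 0 l x a ≤ b :=
  boundHD75Phi_srwTrueAlt_zero_cell_le (by norm_num) (by linarith) hᾱ ha hE0 hE0' hN1 hN2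
    (srwTS_calX_le_tXD hα (by norm_num) (by norm_num) (by omega)) (srwTS_calX_le_tXD hα (by norm_num) (by norm_num) (by omega))
    (srwTS_calX_le_tXD hα (by norm_num) (by norm_num) (by omega))
    (srwU_calX_le (by norm_num) (by norm_num) (by omega)) (srwU_calX_le (by norm_num) (by norm_num) (by omega))
    (srwK_calX_le (by norm_num) (by norm_num) (by omega)) (srwK_calX_le (by norm_num) (by norm_num) (by omega)) hnum

/-- **Cells `(1,l)` over `𝒳`, `boundHD75Phi`, direct `T` slot `tXD α̲`** (`l ≤ 20`) — twin of `CellSupD10.f3cellD10D_one_calX_le`.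
[cite: FitznerVanDerHofstad2016NoBLE, §3.3.5 (3.87) p. 1079; (3.71)–(3.86); §5.2 (5.9), (5.15)] [cite: FitznerVanDerHofstad2017, §2.5; notebook General.nb In[2]–In[3]] -/
theorem f3cellD10D_one_calX_le_phi (hα : 1 ≤ afmin) (hᾱ : 1 ≤ afmax) {a : Args} (ha : a.WF)
    {IMc : ℤ → ℕ → ℝ} {l : ℕ} (hl : l ≤ 20) {b : ℝ}
    (hE1 : CellDomAlt 10 afmin afmax 1 l (IMc 1 l)) (hE0 : CellDomAlt 10 afmin afmax 0 l (IMc 0 l))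
    (hE1' : CellDomAlt 10 afmin afmax 1 (l + 1) (IMc 1 (l + 1))) (hE0' : CellDomAlt 10 afmin afmax 0 (l + 1) (IMc 0 (l + 1)))
    (hE1'' : CellDomAlt 10 afmin afmax 1 (l + 2) (IMc 1 (l + 2)))
    (hnum : boundHD75Phi (Tables.cell IMc (tXD afmin) uX kX : Tables (Fin 10 → ℤ)) 1 l 0 a ≤ b) :
    ∀ x ∈ calX 10, boundHD75Phi (srwTrueAlt 10 afmin afmax) 1 l x a ≤ b :=
  boundHD75Phi_srwTrueAlt_one_cell_le (by norm_num) (by linarith) hᾱ ha hE1 hE0 hE1' hE0' hE1''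
    (srwTS_calX_le_tXD hα (by norm_num) (by norm_num) (by omega)) (srwTS_calX_le_tXD hα (by norm_num) (by norm_num) (by omega))
    (srwTS_calX_le_tXD hα (by norm_num) (by norm_num) (by omega))
    (srwU_calX_le (by norm_num) (by norm_num) (by omega)) (srwU_calX_le (by norm_num) (by norm_num) (by omega))
    (srwK_calX_le (by norm_num) (by norm_num) (by omega)) (srwK_calX_le (by norm_num) (by norm_num) (by omega)) hnum

/-- **Cell `(0,l)` over a set `C ⊆ Q10`, `boundHD75Phi`, direct `T` slot `tQD α̲`** (`l ≤ 20`) — twin of `CellSupD10.f3cellD10D_zero_on_le`.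
[cite: FitznerVanDerHofstad2016NoBLE, §3.3.5 (3.87) p. 1079; §5.1 p. 1093; (3.71)–(3.86); §5.2 (5.9), (5.15)] [cite: FitznerVanDerHofstad2017, §2.5; notebook Percolation.nb (`boundF3[2,o]`, `boundF3[3,o]`)] -/
theorem f3cellD10D_zero_on_le_phi {C : Set (Fin 10 → ℤ)} (hC : C ⊆ Q10) (hα : 1 ≤ afmin) (hᾱ : 1 ≤ afmax) {a : Args} (ha : a.WF)
    {IMc : ℤ → ℕ → ℝ} {l : ℕ} (hl : l ≤ 20) {b : ℝ}
    (hE0 : OnDomAlt 10 afmin afmax C 0 l (IMc 0 l)) (hE0' : OnDomAlt 10 afmin afmax C 0 (l + 1) (IMc 0 (l + 1)))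
    (hN1 : ∀ x ∈ C, srwI 10 1 (l + 1) x + srwIShift2 10 2 l x / (2 * ((10 : ℕ) : ℝ) ^ 2 * afmin) ≤ IMc (-1) l)
    (hN2 : ∀ x ∈ C, srwI 10 2 l x ≤ ((10 : ℕ) : ℝ) * afmin * IMc (-1) l)
    (hnum : boundHD75Phi (Tables.cell IMc (tQD afmin) uQ kQ : Tables (Fin 10 → ℤ)) 0 l 0 a ≤ b) :
    ∀ x ∈ C, boundHD75Phi (srwTrueAlt 10 afmin afmax) 0 l x a ≤ b :=
  boundHD75Phi_srwTrueAlt_zero_le_on (by norm_num) (by linarith) hᾱ ha C hE0 hE0' hN1 hN2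
    (srwTS_le_tQD_on hC hα (by norm_num) (by norm_num) (by omega)) (srwTS_le_tQD_on hC hα (by norm_num) (by norm_num) (by omega))
    (srwTS_le_tQD_on hC hα (by norm_num) (by norm_num) (by omega))
    (srwU_le_uQ_on hC (by norm_num) (by norm_num) (by omega)) (srwU_le_uQ_on hC (by norm_num) (by norm_num) (by omega))
    (srwK_le_kQ_on hC (by norm_num) (by norm_num) (by omega)) (srwK_le_kQ_on hC (by norm_num) (by norm_num) (by omega)) hnum

/-- **Cells `(1,l)` over a set `C ⊆ Q10`, `boundHD75Phi`, direct `T` slot `tQD α̲`** (`l ≤ 20`) — twin of `CellSupD10.f3cellD10D_one_on_le`.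
[cite: FitznerVanDerHofstad2016NoBLE, §3.3.5 (3.87) p. 1079; §5.1 p. 1093; (3.71)–(3.86); §5.2 (5.9), (5.15)] [cite: FitznerVanDerHofstad2017, §2.5; notebook Percolation.nb (`boundF3[2,o]`, `boundF3[3,o]`)] -/
theorem f3cellD10D_one_on_le_phi {C : Set (Fin 10 → ℤ)} (hC : C ⊆ Q10) (hα : 1 ≤ afmin) (hᾱ : 1 ≤ afmax) {a : Args} (ha : a.WF)
    {IMc : ℤ → ℕ → ℝ} {l : ℕ} (hl : l ≤ 20) {b : ℝ}
    (hE1 : OnDomAlt 10 afmin afmax C 1 l (IMc 1 l)) (hE0 : OnDomAlt 10 afmin afmax C 0 l (IMc 0 l))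
    (hE1' : OnDomAlt 10 afmin afmax C 1 (l + 1) (IMc 1 (l + 1))) (hE0' : OnDomAlt 10 afmin afmax C 0 (l + 1) (IMc 0 (l + 1)))
    (hE1'' : OnDomAlt 10 afmin afmax C 1 (l + 2) (IMc 1 (l + 2)))
    (hnum : boundHD75Phi (Tables.cell IMc (tQD afmin) uQ kQ : Tables (Fin 10 → ℤ)) 1 l 0 a ≤ b) :
    ∀ x ∈ C, boundHD75Phi (srwTrueAlt 10 afmin afmax) 1 l x a ≤ b :=
  boundHD75Phi_srwTrueAlt_one_le_on (by norm_num) (by linarith) hᾱ ha C hE1 hE0 hE1' hE0' hE1''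
    (srwTS_le_tQD_on hC hα (by norm_num) (by norm_num) (by omega)) (srwTS_le_tQD_on hC hα (by norm_num) (by norm_num) (by omega))
    (srwTS_le_tQD_on hC hα (by norm_num) (by norm_num) (by omega))
    (srwU_le_uQ_on hC (by norm_num) (by norm_num) (by omega)) (srwU_le_uQ_on hC (by norm_num) (by norm_num) (by omega))
    (srwK_le_kQ_on hC (by norm_num) (by norm_num) (by omega)) (srwK_le_kQ_on hC (by norm_num) (by norm_num) (by omega)) hnum

/-- **Cell `(1,l)` at the origin, `boundHD75Phi`, direct `T` slot `tND α̲ n0`** (`l ≤ 16`) — twin of `CellSupD10.f3cellD10D_one_zero_le`.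
[cite: FitznerVanDerHofstad2016NoBLE, §3.3.5 (3.87) p. 1079 (cell `{0}`); (3.30), (3.35); §5.2 (5.9), (5.15)] [cite: FitznerVanDerHofstad2017, §2.5; notebook Percolation.nb (`boundF3[1,o]`)] -/
theorem f3cellD10D_one_zero_le_phi (hα : 1 ≤ afmin) {a : Args} (ha : a.WF)
    {IMc : ℤ → ℕ → ℝ} {l : ℕ} (hl : l ≤ 16) {b : ℝ}
    (hE1 : OriginDomAlt 10 afmin afmax 1 l (IMc 1 l)) (hE0 : OriginDomAlt 10 afmin afmax 0 l (IMc 0 l))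
    (hE1' : OriginDomAlt 10 afmin afmax 1 (l + 1) (IMc 1 (l + 1))) (hE0' : OriginDomAlt 10 afmin afmax 0 (l + 1) (IMc 0 (l + 1)))
    (hE1'' : OriginDomAlt 10 afmin afmax 1 (l + 2) (IMc 1 (l + 2)))
    (hnum : boundHD75Phi (Tables.cell IMc (tND afmin .n0) (uN .n0) (kN .n0) : Tables (Fin 10 → ℤ)) 1 l 0 a ≤ b) :
    boundHD75Phi (srwTrueAlt 10 afmin afmax) 1 l 0 a ≤ b :=
  boundHD75Phi_srwTrueAlt_one_zero_le (by norm_num) (by linarith) ha hE1 hE0 hE1' hE0' hE1''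
    (srwTS_zero_le_tND hα (by norm_num) (by norm_num) (by omega)) (srwTS_zero_le_tND hα (by norm_num) (by norm_num) (by omega))
    (srwTS_zero_le_tND hα (by norm_num) (by norm_num) (by omega))
    (srwU_zero_le (by norm_num) (by norm_num) (by omega)) (srwU_zero_le (by norm_num) (by norm_num) (by omega))
    (srwK_zero_le (by norm_num) (by norm_num) (by omega)) (srwK_zero_le (by norm_num) (by norm_num) (by omega)) hnum

/-- **Cell `(0,l)` AT the node `nd`, `boundHD75Phi`, direct `T` slot `tND α̲ nd`** (`l ≤ 16`) — twin of `CellSupD10.f3cellD10D_zero_at_le`.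
[cite: FitznerVanDerHofstad2016NoBLE, §3.3.5 (3.87) p. 1079; (3.71)–(3.86); §5.2 (5.9), (5.15)] [cite: FitznerVanDerHofstad2017, §2.5, notebook Percolation.nb] -/
theorem f3cellD10D_zero_at_le_phi (hα : 1 ≤ afmin) {a : Args} (ha : a.WF) (nd : Nd)
    {IMc : ℤ → ℕ → ℝ} {l : ℕ} (hl : l ≤ 16) {b : ℝ}
    (hE0 : (srwTrueAlt 10 afmin afmax).IM 0 l nd.pt ≤ IMc 0 l) (hE0' : (srwTrueAlt 10 afmin afmax).IM 0 (l + 1) nd.pt ≤ IMc 0 (l + 1))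
    (hN1 : srwI 10 1 (l + 1) nd.pt + srwIShift2 10 2 l nd.pt / (2 * ((10 : ℕ) : ℝ) ^ 2 * afmin) ≤ IMc (-1) l)
    (hN2 : srwI 10 2 l nd.pt ≤ ((10 : ℕ) : ℝ) * afmin * IMc (-1) l)
    (hnum : boundHD75Phi (Tables.cell IMc (tND afmin nd) (uN nd) (kN nd) : Tables (Fin 10 → ℤ)) 0 l 0 a ≤ b) :
    boundHD75Phi (srwTrueAlt 10 afmin afmax) 0 l nd.pt a ≤ b :=
  boundHD75Phi_srwTrueAlt_zero_at_le (by norm_num) (by linarith) ha nd.pt hE0 hE0' hN1 hN2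
    (srwTS_pt_le_tND hα nd (by norm_num) (by norm_num) (by omega)) (srwTS_pt_le_tND hα nd (by norm_num) (by norm_num) (by omega))
    (srwTS_pt_le_tND hα nd (by norm_num) (by norm_num) (by omega))
    (srwU_pt_le nd (by norm_num) (by norm_num) (by omega)) (srwU_pt_le nd (by norm_num) (by norm_num) (by omega))
    (srwK_pt_le nd (by norm_num) (by norm_num) (by omega)) (srwK_pt_le nd (by norm_num) (by norm_num) (by omega)) hnum

/-- **Cells `(1,l)` AT the node `nd`, `boundHD75Phi`, direct `T` slot `tND α̲ nd`** (`l ≤ 16`) — twin of `CellSupD10.f3cellD10D_one_at_le`.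
[cite: FitznerVanDerHofstad2016NoBLE, §3.3.5 (3.87) p. 1079; (3.71)–(3.86); §5.2 (5.9), (5.15)] [cite: FitznerVanDerHofstad2017, §2.5, notebook Percolation.nb] -/
theorem f3cellD10D_one_at_le_phi (hα : 1 ≤ afmin) {a : Args} (ha : a.WF) (nd : Nd)
    {IMc : ℤ → ℕ → ℝ} {l : ℕ} (hl : l ≤ 16) {b : ℝ}
    (hE1 : (srwTrueAlt 10 afmin afmax).IM 1 l nd.pt ≤ IMc 1 l) (hE0 : (srwTrueAlt 10 afmin afmax).IM 0 l nd.pt ≤ IMc 0 l)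
    (hE1' : (srwTrueAlt 10 afmin afmax).IM 1 (l + 1) nd.pt ≤ IMc 1 (l + 1))
    (hE0' : (srwTrueAlt 10 afmin afmax).IM 0 (l + 1) nd.pt ≤ IMc 0 (l + 1))
    (hE1'' : (srwTrueAlt 10 afmin afmax).IM 1 (l + 2) nd.pt ≤ IMc 1 (l + 2))
    (hnum : boundHD75Phi (Tables.cell IMc (tND afmin nd) (uN nd) (kN nd) : Tables (Fin 10 → ℤ)) 1 l 0 a ≤ b) :
    boundHD75Phi (srwTrueAlt 10 afmin afmax) 1 l nd.pt a ≤ b :=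
  boundHD75Phi_srwTrueAlt_one_at_le ha nd.pt hE1 hE0 hE1' hE0' hE1''
    (srwTS_pt_le_tND hα nd (by norm_num) (by norm_num) (by omega)) (srwTS_pt_le_tND hα nd (by norm_num) (by norm_num) (by omega))
    (srwTS_pt_le_tND hα nd (by norm_num) (by norm_num) (by omega))
    (srwU_pt_le nd (by norm_num) (by norm_num) (by omega)) (srwU_pt_le nd (by norm_num) (by norm_num) (by omega))
    (srwK_pt_le nd (by norm_num) (by norm_num) (by omega)) (srwK_pt_le nd (by norm_num) (by norm_num) (by omega)) hnum

/-- **Per-cone reading of an `𝒳`-cell at `d := 10`, `boundHD75Phi`**: from the values AT the two shell nodes `e2`, `e11` and bounds on the three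
cones of `3e₁`, `2e₁+e₂`, `e₁+e₂+e₃` — twin of `CellSupD10.f3cellD10_calX_le_of_nodes_of_cones`.
[cite: FitznerVanDerHofstad2016NoBLE, §3.3.5 (3.87) p. 1079; §5.1 p. 1093] [cite: FitznerVanDerHofstad2017, §2.5; notebook Percolation.nb (`boundF3[2,o]`, `boundF3[3,o]` read per cone)] -/
theorem f3cellD10_calX_le_of_nodes_of_cones_phi {n l : ℕ} {a : Args} {b : ℝ}
    (h2 : boundHD75Phi (srwTrueAlt 10 afmin afmax) n l (Nd.pt .e2) a ≤ b)
    (h11 : boundHD75Phi (srwTrueAlt 10 afmin afmax) n l (Nd.pt .e11) a ≤ b)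
    (h3 : ∀ x ∈ absCone (vecOfParts 10 [3]), boundHD75Phi (srwTrueAlt 10 afmin afmax) n l x a ≤ b)
    (h21 : ∀ x ∈ absCone (vecOfParts 10 [2, 1]), boundHD75Phi (srwTrueAlt 10 afmin afmax) n l x a ≤ b)
    (h111 : ∀ x ∈ absCone (vecOfParts 10 [1, 1, 1]), boundHD75Phi (srwTrueAlt 10 afmin afmax) n l x a ≤ b) :
    ∀ x ∈ calX 10, boundHD75Phi (srwTrueAlt 10 afmin afmax) n l x a ≤ b := by
  rw [pt_e2_eq_vecOfParts] at h2
  rw [pt_e11_eq_classVec] at h11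
  exact boundHD75Phi_srwTrueAlt_calX_le_of_nodes_of_absCones (by norm_num) h2 h11 h3 h21 h111

/-- **A `Q`-cell bound, `boundHD75Phi`, from its three cone bounds** (shape `∀ x, 3 ≤ Σ_j |x_j| → …`) — twin of `CellImD10.boundHD75_Q_le_of_cones`.
[cite: FitznerVanDerHofstad2016NoBLE, §3.3.5 (3.87) p. 1079; §5.1 p. 1093] -/
theorem boundHD75Phi_Q_le_of_cones {n l : ℕ} {a : Args} {b : ℝ}
    (h3 : ∀ x ∈ Cn.cone .v3, boundHD75Phi (srwTrueAlt 10 afmin afmax) n l x a ≤ b)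
    (h21 : ∀ x ∈ Cn.cone .v21, boundHD75Phi (srwTrueAlt 10 afmin afmax) n l x a ≤ b)
    (h111 : ∀ x ∈ Cn.cone .v111, boundHD75Phi (srwTrueAlt 10 afmin afmax) n l x a ≤ b) :
    ∀ x : Fin 10 → ℤ, 3 ≤ ∑ j, |x j| → boundHD75Phi (srwTrueAlt 10 afmin afmax) n l x a ≤ b :=
  boundHD75Phi_srwTrueAlt_three_le_of_absCones (by norm_num) h3 h21 h111

end Wired

/-! ### §2  Closing rules: the numeral hypothesis over `ℚ` -/

/-- **Closing rule, `boundHD75Phi`, direct `T` slot over `𝒳`**: `boundHD75PhiQ IMq (tXDQ α) uS2 kS2 n l aq ≤ bq` gives `hnum` of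
`f3cellD10D_{zero,one}_calX_le_phi` at `(α : ℝ)`, `aq.toArgs`, `(bq : ℝ)`.
[cite: FitznerVanDerHofstad2016NoBLE, §3.3.5 (3.87) p. 1079; §5.2 (5.9), (5.11), (5.15) p. 1092] [cite: FitznerVanDerHofstad2017, §2.5] -/
theorem boundHD75Phi_cellXD_le_of_ratLe (IMq : ℤ → ℕ → ℚ) {α : ℚ} {n l : ℕ} {aq : ArgsQ} {bq : ℚ}
    (h : boundHD75PhiQ IMq (tXDQ α) uS2 kS2 n l aq ≤ bq) :
    boundHD75Phi (Tables.cell (fun m l => ((IMq m l : ℚ) : ℝ)) (tXD (α : ℝ)) uX kX : Tables (Fin 10 → ℤ)) n l 0 aq.toArgs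
      ≤ ((bq : ℚ) : ℝ) := by
  rw [tXD_eq_cast]
  exact boundHD75Phi_cell_le_of_ratLe IMq (tXDQ α) uS2 kS2 0 h

/-- **Closing rule, `boundHD75Phi`, direct `T` slot over `Q10` / the cones**: the `hnum` of `f3cellD10D_{zero,one}_on_le_phi`.
[cite: FitznerVanDerHofstad2016NoBLE, §3.3.5 (3.87) p. 1079; §5.1 p. 1093; §5.2 (5.9), (5.11), (5.15) p. 1092] [cite: FitznerVanDerHofstad2017, §2.5] -/
theorem boundHD75Phi_cellQD_le_of_ratLe (IMq : ℤ → ℕ → ℚ) {α : ℚ} {n l : ℕ} {aq : ArgsQ} {bq : ℚ}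
    (h : boundHD75PhiQ IMq (tQDQ α) uS3 kS3 n l aq ≤ bq) :
    boundHD75Phi (Tables.cell (fun m l => ((IMq m l : ℚ) : ℝ)) (tQD (α : ℝ)) uQ kQ : Tables (Fin 10 → ℤ)) n l 0 aq.toArgs
      ≤ ((bq : ℚ) : ℝ) := by
  rw [tQD_eq_cast]
  exact boundHD75Phi_cell_le_of_ratLe IMq (tQDQ α) uS3 kS3 0 h

/-- **Closing rule, `boundHD75Phi`, direct `T` slot AT the node `nd`** (origin `nd = .n0`, shell nodes, `e₁`): the `hnum` of
`f3cellD10D_one_zero_le_phi` / `f3cellD10D_{zero,one}_at_le_phi`.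
[cite: FitznerVanDerHofstad2016NoBLE, §3.3.5 (3.87) p. 1079; §5.2 (5.9), (5.11), (5.15) p. 1092] [cite: FitznerVanDerHofstad2017, §2.5] -/
theorem boundHD75Phi_cellND_le_of_ratLe (IMq : ℤ → ℕ → ℚ) {α : ℚ} (nd : Nd) {n l : ℕ} {aq : ArgsQ} {bq : ℚ}
    (h : boundHD75PhiQ IMq (tNDQ α nd) (fun n l => uA n l nd) (fun n l => kA n l nd) n l aq ≤ bq) :
    boundHD75Phi (Tables.cell (fun m l => ((IMq m l : ℚ) : ℝ)) (tND (α : ℝ) nd) (uN nd) (kN nd) : Tables (Fin 10 → ℤ)) n l 0 aq.toArgs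
      ≤ ((bq : ℚ) : ℝ) := by
  rw [tND_eq_cast]
  exact boundHD75Phi_cell_le_of_ratLe IMq (tNDQ α nd) (fun n l => uA n l nd) (fun n l => kA n l nd) 0 h

/-! ### §3  Per-slot closing theorems with decidable hypotheses only -/

section Slot

variable {α amax bq : ℚ} {aq : ArgsQ} {IMq : ℤ → ℕ → ℚ} {l : ℕ}

/-- **`𝒳`-cell `(0,l)`, `boundHD75Phi`, direct `T` slot, all hypotheses decidable** — twin of `SlotD10.slotXD_zero_le`.
[cite: FitznerVanDerHofstad2016NoBLE, §3.3.5 (3.87) p. 1079; (3.58)–(3.64) p. 1076; §5.2 (5.9), (5.15) p. 1092] [cite: FitznerVanDerHofstad2017, §2.5] -/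
theorem slotXD_zero_le_phi (hα : 1 ≤ α) (hᾱ : 1 ≤ amax) (hwf : aq.wfCheck = true) (hl : l ≤ 20)
    (hE0 : cellChk α amax 0 l (IMq 0 l) = true) (hE0' : cellChk α amax 0 (l + 1) (IMq 0 (l + 1)) = true)
    (hN1 : negOneFstChk α l (IMq (-1) l) = true) (hN2 : negOneSndChk α l (IMq (-1) l) = true)
    (hnum : boundHD75PhiQ IMq (tXDQ α) uS2 kS2 0 l aq ≤ bq) :
    ∀ x ∈ calX 10, boundHD75Phi (srwTrueAlt 10 (α : ℝ) (amax : ℝ)) 0 l x aq.toArgs ≤ ((bq : ℚ) : ℝ) :=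
  have hα0 : 0 < α := by linarith
  f3cellD10D_zero_calX_le_phi (by exact_mod_cast hα) (by exact_mod_cast hᾱ) (ArgsQ.toArgs_WF hwf)
    (IMc := fun m l => ((IMq m l : ℚ) : ℝ)) hl
    (cellDomAlt_of_chk hα0 hᾱ hE0) (cellDomAlt_of_chk hα0 hᾱ hE0') (negOne_fst_of_chk hα0 hN1) (negOne_snd_of_chk hN2)
    (boundHD75Phi_cellXD_le_of_ratLe IMq hnum)

/-- **`𝒳`-cells `(1,l)`, `boundHD75Phi`, direct `T` slot, all hypotheses decidable** — twin of `SlotD10.slotXD_one_le`.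
[cite: FitznerVanDerHofstad2016NoBLE, §3.3.5 (3.87) p. 1079; (3.58)–(3.64) p. 1076; §5.2 (5.9), (5.15) p. 1092] [cite: FitznerVanDerHofstad2017, §2.5] -/
theorem slotXD_one_le_phi (hα : 1 ≤ α) (hᾱ : 1 ≤ amax) (hwf : aq.wfCheck = true) (hl : l ≤ 20)
    (hE1 : cellChk α amax 1 l (IMq 1 l) = true) (hE0 : cellChk α amax 0 l (IMq 0 l) = true)
    (hE1' : cellChk α amax 1 (l + 1) (IMq 1 (l + 1)) = true) (hE0' : cellChk α amax 0 (l + 1) (IMq 0 (l + 1)) = true)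
    (hE1'' : cellChk α amax 1 (l + 2) (IMq 1 (l + 2)) = true)
    (hnum : boundHD75PhiQ IMq (tXDQ α) uS2 kS2 1 l aq ≤ bq) :
    ∀ x ∈ calX 10, boundHD75Phi (srwTrueAlt 10 (α : ℝ) (amax : ℝ)) 1 l x aq.toArgs ≤ ((bq : ℚ) : ℝ) :=
  have hα0 : 0 < α := by linarith
  f3cellD10D_one_calX_le_phi (by exact_mod_cast hα) (by exact_mod_cast hᾱ) (ArgsQ.toArgs_WF hwf)
    (IMc := fun m l => ((IMq m l : ℚ) : ℝ)) hl
    (cellDomAlt_of_chk hα0 hᾱ hE1) (cellDomAlt_of_chk hα0 hᾱ hE0) (cellDomAlt_of_chk hα0 hᾱ hE1')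
    (cellDomAlt_of_chk hα0 hᾱ hE0') (cellDomAlt_of_chk hα0 hᾱ hE1'')
    (boundHD75Phi_cellXD_le_of_ratLe IMq hnum)

/-- **Cone cell `(0,l)` on `Cn.cone v`, `boundHD75Phi`, direct `T` slot, all hypotheses decidable** — twin of `SlotD10.slotConeD_zero_le`.
[cite: FitznerVanDerHofstad2016NoBLE, §3.3.5 (3.87) p. 1079; §5.1 p. 1093; (3.58)–(3.64) p. 1076; §5.2 (5.9), (5.15) p. 1092] [cite: FitznerVanDerHofstad2017, §2.5] -/
theorem slotConeD_zero_le_phi (v : Cn) (hα : 1 ≤ α) (hᾱ : 1 ≤ amax) (hwf : aq.wfCheck = true) (hl : l ≤ 20)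
    (hE0 : coneChk v α amax 0 l (IMq 0 l) = true) (hE0' : coneChk v α amax 0 (l + 1) (IMq 0 (l + 1)) = true)
    (hN1 : coneNegOneFstChk v α l (IMq (-1) l) = true) (hN2 : coneNegOneSndChk v α l (IMq (-1) l) = true)
    (hnum : boundHD75PhiQ IMq (tQDQ α) uS3 kS3 0 l aq ≤ bq) :
    ∀ x ∈ v.cone, boundHD75Phi (srwTrueAlt 10 (α : ℝ) (amax : ℝ)) 0 l x aq.toArgs ≤ ((bq : ℚ) : ℝ) :=
  have hα0 : 0 < α := by linarith
  f3cellD10D_zero_on_le_phi v.cone_subset_Q10 (by exact_mod_cast hα) (by exact_mod_cast hᾱ) (ArgsQ.toArgs_WF hwf)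
    (IMc := fun m l => ((IMq m l : ℚ) : ℝ)) hl
    (onDomAlt_of_chk v hᾱ hE0) (onDomAlt_of_chk v hᾱ hE0') (coneNegOne_fst_of_chk v hα0 hN1) (coneNegOne_snd_of_chk v hN2)
    (boundHD75Phi_cellQD_le_of_ratLe IMq hnum)

/-- **Cone cells `(1,l)` on `Cn.cone v`, `boundHD75Phi`, direct `T` slot, all hypotheses decidable** — twin of `SlotD10.slotConeD_one_le`.
[cite: FitznerVanDerHofstad2016NoBLE, §3.3.5 (3.87) p. 1079; §5.1 p. 1093; (3.58)–(3.64) p. 1076; §5.2 (5.9), (5.15) p. 1092] [cite: FitznerVanDerHofstad2017, §2.5] -/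
theorem slotConeD_one_le_phi (v : Cn) (hα : 1 ≤ α) (hᾱ : 1 ≤ amax) (hwf : aq.wfCheck = true) (hl : l ≤ 20)
    (hE1 : coneChk v α amax 1 l (IMq 1 l) = true) (hE0 : coneChk v α amax 0 l (IMq 0 l) = true)
    (hE1' : coneChk v α amax 1 (l + 1) (IMq 1 (l + 1)) = true) (hE0' : coneChk v α amax 0 (l + 1) (IMq 0 (l + 1)) = true)
    (hE1'' : coneChk v α amax 1 (l + 2) (IMq 1 (l + 2)) = true)
    (hnum : boundHD75PhiQ IMq (tQDQ α) uS3 kS3 1 l aq ≤ bq) :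
    ∀ x ∈ v.cone, boundHD75Phi (srwTrueAlt 10 (α : ℝ) (amax : ℝ)) 1 l x aq.toArgs ≤ ((bq : ℚ) : ℝ) :=
  have hα0 : 0 < α := by linarith
  f3cellD10D_one_on_le_phi v.cone_subset_Q10 (by exact_mod_cast hα) (by exact_mod_cast hᾱ) (ArgsQ.toArgs_WF hwf)
    (IMc := fun m l => ((IMq m l : ℚ) : ℝ)) hl
    (onDomAlt_of_chk v hᾱ hE1) (onDomAlt_of_chk v hᾱ hE0) (onDomAlt_of_chk v hᾱ hE1') (onDomAlt_of_chk v hᾱ hE0')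
    (onDomAlt_of_chk v hᾱ hE1'')
    (boundHD75Phi_cellQD_le_of_ratLe IMq hnum)

/-- **Origin cell `(1,l)`, `boundHD75Phi`, direct `T` slot `tND α n0`, all hypotheses decidable** (`l ≤ 16`) — twin of `SlotD10.slotOriginD_one_le`.
[cite: FitznerVanDerHofstad2016NoBLE, §3.3.5 (3.87) p. 1079 (cell `{0}`); (3.30), (3.35) p. 1070; §5.2 (5.9), (5.15) p. 1092] [cite: FitznerVanDerHofstad2017, §2.5] -/
theorem slotOriginD_one_le_phi (hα : 1 ≤ α) (hᾱ : 1 ≤ amax) (hwf : aq.wfCheck = true) (hl : l ≤ 16)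
    (hE1 : originChk α amax 1 l (IMq 1 l) = true) (hE0 : originChk α amax 0 l (IMq 0 l) = true)
    (hE1' : originChk α amax 1 (l + 1) (IMq 1 (l + 1)) = true) (hE0' : originChk α amax 0 (l + 1) (IMq 0 (l + 1)) = true)
    (hE1'' : originChk α amax 1 (l + 2) (IMq 1 (l + 2)) = true)
    (hnum : boundHD75PhiQ IMq (tNDQ α .n0) (fun n l => uA n l .n0) (fun n l => kA n l .n0) 1 l aq ≤ bq) :
    boundHD75Phi (srwTrueAlt 10 (α : ℝ) (amax : ℝ)) 1 l 0 aq.toArgs ≤ ((bq : ℚ) : ℝ) :=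
  have hα0 : 0 < α := by linarith
  f3cellD10D_one_zero_le_phi (afmax := (amax : ℝ)) (by exact_mod_cast hα) (ArgsQ.toArgs_WF hwf)
    (IMc := fun m l => ((IMq m l : ℚ) : ℝ)) hl
    (originDomAlt_of_chk hα0 hᾱ hE1) (originDomAlt_of_chk hα0 hᾱ hE0) (originDomAlt_of_chk hα0 hᾱ hE1')
    (originDomAlt_of_chk hα0 hᾱ hE0') (originDomAlt_of_chk hα0 hᾱ hE1'')
    (boundHD75Phi_cellND_le_of_ratLe IMq .n0 hnum)

/-- The shell node `2e₁` lies in `𝒳`. [cite: FitznerVanDerHofstad2016NoBLE, §3.3.5 p. 1079 (the lowest-order points `2e₁`, `e₁+e₂` of `𝒳`)] -/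
theorem pt_e2_mem_calX : Nd.pt .e2 ∈ calX 10 :=
  mem_calX_of_two_le_sum_abs _ (by rw [pt_e2_eq_vecOfParts]; decide +kernel)

/-- The shell node `e₁+e₂` lies in `𝒳`. [cite: FitznerVanDerHofstad2016NoBLE, §3.3.5 p. 1079 (the lowest-order points `2e₁`, `e₁+e₂` of `𝒳`)] -/
theorem pt_e11_mem_calX : Nd.pt .e11 ∈ calX 10 :=
  mem_calX_of_two_le_sum_abs _ (by rw [pt_e11_eq_classVec]; decide +kernel)

/-- Print's `m = −1` pair AT a node of `𝒳` from the node-form checks over `𝒳` (the node maxima dominate the node values).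
[cite: FitznerVanDerHofstad2016NoBLE, §3.3.5 (3.58), (3.63)–(3.64) pp. 1074–1076; Lemma 5.1 p. 1093] -/
theorem negOne_pair_at_of_chk {nd : Nd} (hnd : nd.pt ∈ calX 10) (hα0 : 0 < α) {t : ℚ}
    (hN1 : negOneFstChk α l t = true) (hN2 : negOneSndChk α l t = true) :
    srwI 10 1 (l + 1) nd.pt + srwIShift2 10 2 l nd.pt / (2 * ((10 : ℕ) : ℝ) ^ 2 * (α : ℝ)) ≤ (t : ℝ) ∧
      srwI 10 2 l nd.pt ≤ ((10 : ℕ) : ℝ) * (α : ℝ) * (t : ℝ) := by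
  have hpos : (0 : ℝ) < 2 * ((10 : ℕ) : ℝ) ^ 2 * (α : ℝ) := by
    have : (0 : ℝ) < (α : ℝ) := by exact_mod_cast hα0
    positivity
  refine ⟨le_trans (add_le_add ?_ ?_) (negOne_fst_of_chk hα0 hN1), le_trans ?_ (negOne_snd_of_chk hN2)⟩
  · exact srwI_le_srwINode2_of_mem_calX (by norm_num) (by norm_num) (l + 1) hnd
  · exact div_le_div_of_nonneg_right (srwIShift2_le_srwIShift2Node2_of_mem_calX (by norm_num) (by norm_num) l hnd) hpos.le
  · exact srwI_le_srwINode2_of_mem_calX (by norm_num) (by norm_num) l hnd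

/-- **Cell `(0,l)` AT a node `nd ∈ 𝒳`, `boundHD75Phi`, direct `T` slot `tND α nd`, all hypotheses decidable** (`l ≤ 16`): the natural-row `IM` entries
from the `𝒳`-cell checks `cellChk` (the node lies in `𝒳`), the `m = −1` pair from `negOne{Fst,Snd}Chk`, `T`/`U`/`K` from the point literals at `nd`.
[cite: FitznerVanDerHofstad2016NoBLE, §3.3.5 (3.87) p. 1079; (3.58)–(3.64) p. 1076; §5.2 (5.9), (5.15) p. 1092] [cite: FitznerVanDerHofstad2017, §2.5; notebook Percolation.nb (`boundF3[2,o]` at the nodes `{2}`, `{1,1}`)] -/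
theorem slotND_zero_at_le_phi (nd : Nd) (hnd : nd.pt ∈ calX 10) (hα : 1 ≤ α) (hᾱ : 1 ≤ amax) (hwf : aq.wfCheck = true) (hl : l ≤ 16)
    (hE0 : cellChk α amax 0 l (IMq 0 l) = true) (hE0' : cellChk α amax 0 (l + 1) (IMq 0 (l + 1)) = true)
    (hN1 : negOneFstChk α l (IMq (-1) l) = true) (hN2 : negOneSndChk α l (IMq (-1) l) = true)
    (hnum : boundHD75PhiQ IMq (tNDQ α nd) (fun n l => uA n l nd) (fun n l => kA n l nd) 0 l aq ≤ bq) :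
    boundHD75Phi (srwTrueAlt 10 (α : ℝ) (amax : ℝ)) 0 l nd.pt aq.toArgs ≤ ((bq : ℚ) : ℝ) :=
  have hα0 : 0 < α := by linarith
  have hαR : (0 : ℝ) < (α : ℝ) := by exact_mod_cast hα0
  have hN := negOne_pair_at_of_chk hnd hα0 hN1 hN2
  f3cellD10D_zero_at_le_phi (afmax := (amax : ℝ)) (by exact_mod_cast hα) (ArgsQ.toArgs_WF hwf) nd
    (IMc := fun m l => ((IMq m l : ℚ) : ℝ)) hl
    (srwTrueAlt_IM_natCast_le_of_cellDomAlt hαR (by exact_mod_cast hᾱ) (by norm_num) (cellDomAlt_of_chk hα0 hᾱ hE0) hnd)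
    (srwTrueAlt_IM_natCast_le_of_cellDomAlt hαR (by exact_mod_cast hᾱ) (by norm_num) (cellDomAlt_of_chk hα0 hᾱ hE0') hnd)
    hN.1 hN.2 (boundHD75Phi_cellND_le_of_ratLe IMq nd hnum)

/-- **Cells `(1,l)` AT a node `nd ∈ 𝒳`, `boundHD75Phi`, direct `T` slot `tND α nd`, all hypotheses decidable** (`l ≤ 16`).
[cite: FitznerVanDerHofstad2016NoBLE, §3.3.5 (3.87) p. 1079; (3.58)–(3.64) p. 1076; §5.2 (5.9), (5.15) p. 1092] [cite: FitznerVanDerHofstad2017, §2.5; notebook Percolation.nb (`boundF3[3,o]` at the nodes `{2}`, `{1,1}`)] -/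
theorem slotND_one_at_le_phi (nd : Nd) (hnd : nd.pt ∈ calX 10) (hα : 1 ≤ α) (hᾱ : 1 ≤ amax) (hwf : aq.wfCheck = true) (hl : l ≤ 16)
    (hE1 : cellChk α amax 1 l (IMq 1 l) = true) (hE0 : cellChk α amax 0 l (IMq 0 l) = true)
    (hE1' : cellChk α amax 1 (l + 1) (IMq 1 (l + 1)) = true) (hE0' : cellChk α amax 0 (l + 1) (IMq 0 (l + 1)) = true)
    (hE1'' : cellChk α amax 1 (l + 2) (IMq 1 (l + 2)) = true)
    (hnum : boundHD75PhiQ IMq (tNDQ α nd) (fun n l => uA n l nd) (fun n l => kA n l nd) 1 l aq ≤ bq) :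
    boundHD75Phi (srwTrueAlt 10 (α : ℝ) (amax : ℝ)) 1 l nd.pt aq.toArgs ≤ ((bq : ℚ) : ℝ) :=
  have hα0 : 0 < α := by linarith
  have hαR : (0 : ℝ) < (α : ℝ) := by exact_mod_cast hα0
  have hᾱR : (1 : ℝ) ≤ (amax : ℝ) := by exact_mod_cast hᾱ
  f3cellD10D_one_at_le_phi (afmax := (amax : ℝ)) (by exact_mod_cast hα) (ArgsQ.toArgs_WF hwf) nd
    (IMc := fun m l => ((IMq m l : ℚ) : ℝ)) hl
    (srwTrueAlt_IM_natCast_le_of_cellDomAlt hαR hᾱR (by norm_num) (cellDomAlt_of_chk hα0 hᾱ hE1) hnd)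
    (srwTrueAlt_IM_natCast_le_of_cellDomAlt hαR hᾱR (by norm_num) (cellDomAlt_of_chk hα0 hᾱ hE0) hnd)
    (srwTrueAlt_IM_natCast_le_of_cellDomAlt hαR hᾱR (by norm_num) (cellDomAlt_of_chk hα0 hᾱ hE1') hnd)
    (srwTrueAlt_IM_natCast_le_of_cellDomAlt hαR hᾱR (by norm_num) (cellDomAlt_of_chk hα0 hᾱ hE0') hnd)
    (srwTrueAlt_IM_natCast_le_of_cellDomAlt hαR hᾱR (by norm_num) (cellDomAlt_of_chk hα0 hᾱ hE1'') hnd)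
    (boundHD75Phi_cellND_le_of_ratLe IMq nd hnum)

variable {IM3 IM21 IM111 : ℤ → ℕ → ℚ}

/-- **Cell `(0,l)` on all of `Q`, `boundHD75Phi`, direct `T` slot**, all hypotheses decidable: the three `slotConeD_zero_le_phi v` glued — twin of
`SlotD10.slotQD_zero_le`. [cite: FitznerVanDerHofstad2016NoBLE, §3.3.5 (3.87) p. 1079; §5.1 p. 1093; §5.2 (5.9), (5.15) p. 1092] [cite: FitznerVanDerHofstad2017, §2.5] -/
theorem slotQD_zero_le_phi (hα : 1 ≤ α) (hᾱ : 1 ≤ amax) (hwf : aq.wfCheck = true) (hl : l ≤ 20)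
    (h3E0 : coneChk .v3 α amax 0 l (IM3 0 l) = true) (h3E0' : coneChk .v3 α amax 0 (l + 1) (IM3 0 (l + 1)) = true)
    (h3N1 : coneNegOneFstChk .v3 α l (IM3 (-1) l) = true) (h3N2 : coneNegOneSndChk .v3 α l (IM3 (-1) l) = true)
    (h3num : boundHD75PhiQ IM3 (tQDQ α) uS3 kS3 0 l aq ≤ bq)
    (h21E0 : coneChk .v21 α amax 0 l (IM21 0 l) = true) (h21E0' : coneChk .v21 α amax 0 (l + 1) (IM21 0 (l + 1)) = true)
    (h21N1 : coneNegOneFstChk .v21 α l (IM21 (-1) l) = true) (h21N2 : coneNegOneSndChk .v21 α l (IM21 (-1) l) = true)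
    (h21num : boundHD75PhiQ IM21 (tQDQ α) uS3 kS3 0 l aq ≤ bq)
    (h111E0 : coneChk .v111 α amax 0 l (IM111 0 l) = true) (h111E0' : coneChk .v111 α amax 0 (l + 1) (IM111 0 (l + 1)) = true)
    (h111N1 : coneNegOneFstChk .v111 α l (IM111 (-1) l) = true) (h111N2 : coneNegOneSndChk .v111 α l (IM111 (-1) l) = true)
    (h111num : boundHD75PhiQ IM111 (tQDQ α) uS3 kS3 0 l aq ≤ bq) :
    ∀ x : Fin 10 → ℤ, 3 ≤ ∑ j, |x j| → boundHD75Phi (srwTrueAlt 10 (α : ℝ) (amax : ℝ)) 0 l x aq.toArgs ≤ ((bq : ℚ) : ℝ) :=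
  boundHD75Phi_Q_le_of_cones
    (slotConeD_zero_le_phi .v3 hα hᾱ hwf hl h3E0 h3E0' h3N1 h3N2 h3num)
    (slotConeD_zero_le_phi .v21 hα hᾱ hwf hl h21E0 h21E0' h21N1 h21N2 h21num)
    (slotConeD_zero_le_phi .v111 hα hᾱ hwf hl h111E0 h111E0' h111N1 h111N2 h111num)

/-- **Cell `(1,l)` on all of `Q`, `boundHD75Phi`, direct `T` slot**, all hypotheses decidable: the three `slotConeD_one_le_phi v` glued — twin of
`SlotD10.slotQD_one_le`. [cite: FitznerVanDerHofstad2016NoBLE, §3.3.5 (3.87) p. 1079; §5.1 p. 1093; §5.2 (5.9), (5.15) p. 1092] [cite: FitznerVanDerHofstad2017, §2.5] -/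
theorem slotQD_one_le_phi (hα : 1 ≤ α) (hᾱ : 1 ≤ amax) (hwf : aq.wfCheck = true) (hl : l ≤ 20)
    (h3E1 : coneChk .v3 α amax 1 l (IM3 1 l) = true) (h3E0 : coneChk .v3 α amax 0 l (IM3 0 l) = true)
    (h3E1' : coneChk .v3 α amax 1 (l + 1) (IM3 1 (l + 1)) = true) (h3E0' : coneChk .v3 α amax 0 (l + 1) (IM3 0 (l + 1)) = true)
    (h3E1'' : coneChk .v3 α amax 1 (l + 2) (IM3 1 (l + 2)) = true)
    (h3num : boundHD75PhiQ IM3 (tQDQ α) uS3 kS3 1 l aq ≤ bq)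
    (h21E1 : coneChk .v21 α amax 1 l (IM21 1 l) = true) (h21E0 : coneChk .v21 α amax 0 l (IM21 0 l) = true)
    (h21E1' : coneChk .v21 α amax 1 (l + 1) (IM21 1 (l + 1)) = true) (h21E0' : coneChk .v21 α amax 0 (l + 1) (IM21 0 (l + 1)) = true)
    (h21E1'' : coneChk .v21 α amax 1 (l + 2) (IM21 1 (l + 2)) = true)
    (h21num : boundHD75PhiQ IM21 (tQDQ α) uS3 kS3 1 l aq ≤ bq)
    (h111E1 : coneChk .v111 α amax 1 l (IM111 1 l) = true) (h111E0 : coneChk .v111 α amax 0 l (IM111 0 l) = true)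
    (h111E1' : coneChk .v111 α amax 1 (l + 1) (IM111 1 (l + 1)) = true)
    (h111E0' : coneChk .v111 α amax 0 (l + 1) (IM111 0 (l + 1)) = true)
    (h111E1'' : coneChk .v111 α amax 1 (l + 2) (IM111 1 (l + 2)) = true)
    (h111num : boundHD75PhiQ IM111 (tQDQ α) uS3 kS3 1 l aq ≤ bq) :
    ∀ x : Fin 10 → ℤ, 3 ≤ ∑ j, |x j| → boundHD75Phi (srwTrueAlt 10 (α : ℝ) (amax : ℝ)) 1 l x aq.toArgs ≤ ((bq : ℚ) : ℝ) :=
  boundHD75Phi_Q_le_of_cones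
    (slotConeD_one_le_phi .v3 hα hᾱ hwf hl h3E1 h3E0 h3E1' h3E0' h3E1'' h3num)
    (slotConeD_one_le_phi .v21 hα hᾱ hwf hl h21E1 h21E0 h21E1' h21E0' h21E1'' h21num)
    (slotConeD_one_le_phi .v111 hα hᾱ hwf hl h111E1 h111E0 h111E1' h111E0' h111E1'' h111num)

end Slot

/-! ### §4  The `e₁` node: far origin columns of `𝓙`, the reads at `e₁`, the constructor and the slot -/

/-- The node `e₁` of `KTUD10.Nd` is `vecOfParts 10 [1]`. [cite: FitznerVanDerHofstad2016NoBLE, (3.34)–(3.35) p. 1071] -/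
theorem pt_e1_eq_vecOfParts : Nd.pt .e1 = vecOfParts 10 [1] := by decide +kernel

/-- The `𝓙`-reads AT `e₁` used by the cell `(1,16)` at `e₁`: `jE1Q m l ⊒ 𝓙_{m+2,l}(e₁)` for `(m,l) ∈ {0}×{16,17} ∪ {1}×{16,17,18}` — the constants of the
LANDED point values `JSupD10.srwJ_e1_m2l16 / m2l17 / m3l16 / m3l17 / m3l18` (`SrwJSupTableD10E1` §E, 8 significant digits up), `0` elsewhere.
[cite: FitznerVanDerHofstad2016NoBLE, (3.30) p. 1070; (3.34)–(3.35) p. 1071] -/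
def jE1Q : ℕ → ℕ → ℚ
  | 0, 16 => dq 10337489 11
  | 0, 17 => dq 84258147 12
  | 1, 16 => dq 91740792 11
  | 1, 17 => dq 81403304 11
  | 1, 18 => dq 72977489 11
  | _, _ => 0

/-- The index set on which `jE1Q` is a certified read. [cite: FitznerVanDerHofstad2016NoBLE, (3.30) p. 1070] -/
def E1Idx (m l : ℕ) : Prop := (m = 0 ∧ (l = 16 ∨ l = 17)) ∨ (m = 1 ∧ (l = 16 ∨ l = 17 ∨ l = 18))

/-- `E1Idx` is decidable. [cite: FitznerVanDerHofstad2016NoBLE, (3.30) p. 1070] -/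
instance (m l : ℕ) : Decidable (E1Idx m l) := by unfold E1Idx; infer_instance

/-- **`𝓙_{m+2,l}(e₁; 10) ≤ jE1Q m l`** on `E1Idx`, by name from the landed `e₁` point values of `SrwJSupTableD10E1` §E.
[cite: FitznerVanDerHofstad2016NoBLE, (3.30) p. 1070; (3.34)–(3.35) p. 1071] -/
theorem srwJ_e1_le_jE1Q {m l : ℕ} (h : E1Idx m l) : srwJ 10 (m + 2) l (vecOfParts 10 [1]) ≤ ((jE1Q m l : ℚ) : ℝ) := by
  rcases h with ⟨rfl, rfl | rfl⟩ | ⟨rfl, rfl | rfl | rfl⟩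
  · exact srwJ_e1_m2l16
  · exact srwJ_e1_m2l17
  · exact srwJ_e1_m3l16
  · exact srwJ_e1_m3l17
  · exact srwJ_e1_m3l18

/-- `I_{n,l}(e₁; 10)` read from the class table of `e₁` (`l ≤ 22`). [cite: FitznerVanDerHofstad2016NoBLE, (5.1) p. 1090] -/
def iE1Q (n l : ℕ) : ℚ := tab_v1.hi n l

/-- **`I_{n,l}(e₁;10) ≤ iE1Q n l`** (`n ≤ 4`, `l ≤ 22`). [cite: FitznerVanDerHofstad2016NoBLE, (5.1) p. 1090] -/
theorem srwI_e1_le_iE1Q {n l : ℕ} (hn : n ≤ 4) (hl : l ≤ 22) : srwI 10 n l (vecOfParts 10 [1]) ≤ ((iE1Q n l : ℚ) : ℝ) :=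
  srwI_le_hi tab_v1 key_p1 hn (show l ≤ 22 from hl)

/-- The shift-sum majorant AT `e₁` in read form (3.30): `S_{p,l}(e₁) ≤ hi[3e₁] + hi[e₁] + 18·hi[2e₁+e₂]`.
[cite: FitznerVanDerHofstad2016NoBLE, (3.30) p. 1070; (5.1) p. 1090] -/
def sE1Q (p l : ℕ) : ℚ := tab_v001.hi p l + tab_v1.hi p l + 18 * tab_v11.hi p l

/-- **`S_{p,l}(e₁;10) ≤ sE1Q p l`** (`p ≤ 4`, `l ≤ 22`), by `srwIShift2_vecOfParts_one_le_of`. [cite: FitznerVanDerHofstad2016NoBLE, (3.30) p. 1070; (5.1) p. 1090] -/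
theorem srwIShift2_e1_le_sE1Q {p l : ℕ} (hp : p ≤ 4) (hl : l ≤ 22) : srwIShift2 10 p l (vecOfParts 10 [1]) ≤ ((sE1Q p l : ℚ) : ℝ) := by
  refine (srwIShift2_vecOfParts_one_le_of p l (by norm_num) (srwI_le_hi tab_v001 key_p3 hp (show l ≤ 22 from hl))
    (srwI_le_hi tab_v1 key_p1 hp (show l ≤ 22 from hl)) (srwI_le_hi tab_v11 key_p21 hp (show l ≤ 22 from hl))).trans_eq ?_
  simp only [sE1Q]
  push_cast
  ring

/-- **`e₁`-node entry check** (corrected-branch envelope on the `e₁` reads): `E1Idx m l ∧ envQ (jE1Q m l) (iE1Q (m+3) l) (sE1Q (m+3) l) α ᾱ ≤ t`.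
[cite: FitznerVanDerHofstad2016NoBLE, §3.3.5 (3.61)–(3.62), (3.64) p. 1076; (3.30) p. 1070] -/
def e1Chk (α amax : ℚ) (m l : ℕ) (t : ℚ) : Bool :=
  decide (E1Idx m l) && decide (envQ (jE1Q m l) (iE1Q (m + 3) l) (sE1Q (m + 3) l) α amax ≤ t)

/-- **Soundness of `e1Chk`**: the natural-row entry of the ALTERNATIVE true tables AT `e₁` is at most `t` (`0 < α`, `1 ≤ ᾱ`).
[cite: FitznerVanDerHofstad2016NoBLE, §3.3.5 (3.61)–(3.62), (3.64) p. 1076; (3.30) p. 1070] -/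
theorem srwTrueAlt_IM_e1_le_of_chk {α amax t : ℚ} {m l : ℕ} (hα : 0 < α) (hᾱ : 1 ≤ amax) (h : e1Chk α amax m l t = true) :
    (srwTrueAlt 10 (α : ℝ) (amax : ℝ)).IM m l (Nd.pt .e1) ≤ (t : ℝ) := by
  simp only [e1Chk, Bool.and_eq_true, decide_eq_true_eq] at h
  obtain ⟨hidx, henv⟩ := h
  have hl : l ≤ 19 := by rcases hidx with ⟨_, rfl | rfl⟩ | ⟨_, rfl | rfl | rfl⟩ <;> omega
  have hm : m ≤ 1 := by rcases hidx with ⟨rfl, _⟩ | ⟨rfl, _⟩ <;> omega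
  rw [pt_e1_eq_vecOfParts]
  refine srwTrueAlt_IM_natCast_le_of_env_le ?_
  unfold srwEnvIM
  have hαR : (0 : ℝ) < (α : ℝ) := by exact_mod_cast hα
  have hᾱR : (1 : ℝ) ≤ (amax : ℝ) := by exact_mod_cast hᾱ
  have e := cast_envQ (jE1Q m l) (iE1Q (m + 3) l) (sE1Q (m + 3) l) α amax
  have henvR : ((envQ (jE1Q m l) (iE1Q (m + 3) l) (sE1Q (m + 3) l) α amax : ℚ) : ℝ) ≤ (t : ℝ) := by exact_mod_cast henv
  rw [e] at henvR
  push_cast at henvR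
  refine le_trans (H1SlotD80.env_mono 1 2 (by norm_num) hαR hᾱR (srwJ_e1_le_jE1Q hidx) (srwI_e1_le_iE1Q (by omega) (by omega))
    (srwIShift2_e1_le_sE1Q (by omega) (by omega))) ?_
  exact_mod_cast henvR

/-- **Cells `(1,l)` AT the node `e₁`, `boundHD75Phi`, direct `T` slot `tND α e1`, all hypotheses decidable** (`l ≤ 16`): the five natural-row `IM`
entries from `e1Chk`, `T`/`U`/`K` from the point literals at `e₁`.  With `nobleH_single` this is the reading of the family cell `(1, l+1, {0})`.
[cite: FitznerVanDerHofstad2016NoBLE, §3.3.5 (3.87) p. 1079; (3.58)–(3.64) p. 1076; (3.34)–(3.35) p. 1071; §5.2 (5.9), (5.15) p. 1092] [cite: FitznerVanDerHofstad2017, (2.23) (cells with `S = {0}`); §2.5] -/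
theorem slotND_one_at_e1_le_phi {α amax bq : ℚ} {aq : ArgsQ} {IMq : ℤ → ℕ → ℚ} {l : ℕ}
    (hα : 1 ≤ α) (hᾱ : 1 ≤ amax) (hwf : aq.wfCheck = true) (hl : l ≤ 16)
    (hE1 : e1Chk α amax 1 l (IMq 1 l) = true) (hE0 : e1Chk α amax 0 l (IMq 0 l) = true)
    (hE1' : e1Chk α amax 1 (l + 1) (IMq 1 (l + 1)) = true) (hE0' : e1Chk α amax 0 (l + 1) (IMq 0 (l + 1)) = true)
    (hE1'' : e1Chk α amax 1 (l + 2) (IMq 1 (l + 2)) = true)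
    (hnum : boundHD75PhiQ IMq (tNDQ α .e1) (fun n l => uA n l .e1) (fun n l => kA n l .e1) 1 l aq ≤ bq) :
    boundHD75Phi (srwTrueAlt 10 (α : ℝ) (amax : ℝ)) 1 l (Nd.pt .e1) aq.toArgs ≤ ((bq : ℚ) : ℝ) :=
  have hα0 : 0 < α := by linarith
  f3cellD10D_one_at_le_phi (afmax := (amax : ℝ)) (by exact_mod_cast hα) (ArgsQ.toArgs_WF hwf) .e1
    (IMc := fun m l => ((IMq m l : ℚ) : ℝ)) hl
    (srwTrueAlt_IM_e1_le_of_chk hα0 hᾱ hE1) (srwTrueAlt_IM_e1_le_of_chk hα0 hᾱ hE0) (srwTrueAlt_IM_e1_le_of_chk hα0 hᾱ hE1')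
    (srwTrueAlt_IM_e1_le_of_chk hα0 hᾱ hE0') (srwTrueAlt_IM_e1_le_of_chk hα0 hᾱ hE1'')
    (boundHD75Phi_cellND_le_of_ratLe IMq .e1 hnum)

/-! ### §5  Convenience `IM` tables passing the checks by construction -/

/-- `IM` table over `𝒳` (and at the shell nodes of `𝒳`): corrected-branch envelope on the natural rows, print's `m = −1` pair in node form.
[cite: FitznerVanDerHofstad2016NoBLE, §3.3.5 (3.58)–(3.64) pp. 1074–1076; Lemma 5.1 p. 1093] -/
def imEX (α amax : ℚ) : ℤ → ℕ → ℚ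
  | .ofNat m, l => envQ (jXQ m l) (iN2Q (m + 3) l) (sN2Q (m + 3) l) α amax
  | .negSucc _, l => max (iN2Q 1 (l + 1) + sN2Q 2 l / (2 * 10 ^ 2 * α)) (iN2Q 2 l / (10 * α))

/-- `IM` table on the cone `Cn.cone v` of `Q`: corrected-branch envelope on the natural rows, print's `m = −1` pair in cone form.
[cite: FitznerVanDerHofstad2016NoBLE, §3.3.5 (3.58)–(3.64) pp. 1074–1076; §5.1 p. 1093] -/
def imEC (v : Cn) (α amax : ℚ) : ℤ → ℕ → ℚ
  | .ofNat m, l => envQ (jCQ v m l) (iCQ v (m + 3) l) (sCQ v (m + 3) l) α amax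
  | .negSucc _, l => max (iCQ v 1 (l + 1) + sCQ v 2 l / (2 * 10 ^ 2 * α)) (iCQ v 2 l / (10 * α))

/-- `IM` table at the origin: corrected-branch envelope on the natural rows (`m = −1` is not read by the `n = 1` cell).
[cite: FitznerVanDerHofstad2016NoBLE, §3.3.5 (3.58)–(3.64) pp. 1074–1076; (3.30) p. 1070] -/
def imEO (α amax : ℚ) : ℤ → ℕ → ℚ
  | .ofNat m, l => envQ (jOQ m l) (i0Q (m + 3) l) (2 * 10 * i2Q (m + 3) l) α amax
  | .negSucc _, _ => 0

/-- `IM` table at the node `e₁`: corrected-branch envelope on the natural rows of `E1Idx` (`m = −1` is not read by the `n = 1` cell).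
[cite: FitznerVanDerHofstad2016NoBLE, §3.3.5 (3.58)–(3.64) pp. 1074–1076; (3.30) p. 1070; (3.34)–(3.35) p. 1071] -/
def imEE1 (α amax : ℚ) : ℤ → ℕ → ℚ
  | .ofNat m, l => envQ (jE1Q m l) (iE1Q (m + 3) l) (sE1Q (m + 3) l) α amax
  | .negSucc _, _ => 0

end SlotD10Phi

end Literature.Probability.FitznerVanDerHofstad2017

end
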